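import Literature.Computability.MetaComplexity.GapMINKTNWSampler
import Literature.Computability.Complexity.UniformProbBlocks
import Literature.Computability.Complexity.CoinCounting
import Literature.Computability.Complexity.StackWords
import Literature.Computability.Complexity.BrickAlgebra
import Mathlib.Analysis.Real.Pi.Bounds
import Mathlib.Analysis.Complex.ExponentialBounds
import HarnessLib

/-!
# The torsion-witness sampler: trials, coins and parameters

The probabilistic and numerical bookkeeping of the `3 ∣ h(−d)` sampler (Hallgren 2005, §4; the
randomness as in Arora–Barak 2009, §7.1, §7.4.1):

* `le_uniformProb_pair` — a coin block of `A + ρ` bits read as `(a, k) = (1 + val(first A bits),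
  val(next ρ bits))` hits every pair `1 ≤ a ≤ 2^A`, `k < 2^ρ` exactly once, so the probability of a
  property of `(a, k)` is at least `#{good pairs} / 2^{A+ρ}`;
* `le_uniformProb_exists_block` — `T` independent trials of success probability `≥ p` with `Tp ≥ 3`
  succeed at least once with probability `≥ 3/4` (`(1 − p)^T ≤ 1/(1 + Tp)`);
* the parameters `kBits n = 5|bin n|` (so `n⁵ < 2^{kBits n} ≤ 32 n⁵`) and the LARGENESS inequalities
  in `n = |bin d|`: for `n ≥ 18` and `c·n ≥ 330` one has `4 < d`, `6π log d / c ≤ √d`, `d³ ≤ 2^{3n}`,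
  `3π(1 + log 2^{3n})³ log d / c ≤ 2^{kBits n}` and `3 ≤ n⁷ · 2c / (3π · 2^{kBits n} · log d)`
  (`large_conditions`), from `π < 3.15` and `log 2 < 0.6932`.

## References

* S. Hallgren, *Fast quantum algorithms for computing the unit group and class group of a number
  field*, STOC 2005, §4 [Hallgren2005].
* S. Arora, B. Barak, *Computational Complexity: A Modern Approach*, CUP 2009, §7.1, §7.4.1
  [AroraBarak2009].
-/

open Finset

namespace Literature.Computability.Cryptography.Hallgren2005

namespace TorsionWitness

open _root_.Computability Literature.Computability.Complexity

/-! ### One trial: pairs `(a, k)` from a coin block -/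

open Classical in
/-- **A block of `A + ρ` coins covers every pair `(a, k)`, `1 ≤ a ≤ 2^A`, `k < 2^ρ`, once**:
`#{good pairs} / 2^{A+ρ} ≤ Pr_{blk}[good (1 + val(blk↾A), val((blk⇂A)↾ρ))]`. [cite: AroraBarak2009, §7.1] -/
theorem le_uniformProb_pair (A ρ : ℕ) (P : ℕ → ℕ → Prop) :
    ((∑ a ∈ Icc 1 (2 ^ A), ((Finset.range (2 ^ ρ)).filter (P a)).card : ℕ) : ℝ) / 2 ^ (A + ρ) ≤
      uniformProb (A + ρ) {blk | P (1 + bitsToNat (blk.take A)) (bitsToNat ((blk.drop A).take ρ))} := by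
  unfold uniformProb
  refine div_le_div_of_nonneg_right ?_ (by positivity)
  set s : Finset ((_ : ℕ) × ℕ) := (Icc 1 (2 ^ A)).sigma fun a => (Finset.range (2 ^ ρ)).filter (P a) with hs
  have hcard : (∑ a ∈ Icc 1 (2 ^ A), ((Finset.range (2 ^ ρ)).filter (P a)).card) = s.card := by
    rw [hs, Finset.card_sigma]
  rw [hcard]
  have hlen : ∀ ak : (_ : ℕ) × ℕ, (natToWord A (ak.1 - 1) ++ natToWord ρ ak.2).length = A + ρ := fun ak => by
    simp
  set f : (_ : ℕ) × ℕ → List.Vector Bool (A + ρ) := fun ak => ⟨natToWord A (ak.1 - 1) ++ natToWord ρ ak.2, hlen ak⟩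
    with hf
  have htake : ∀ ak : (_ : ℕ) × ℕ, (natToWord A (ak.1 - 1) ++ natToWord ρ ak.2).take A = natToWord A (ak.1 - 1) :=
    fun ak => List.take_left' (length_natToWord _ _)
  have hdrop : ∀ ak : (_ : ℕ) × ℕ, ((natToWord A (ak.1 - 1) ++ natToWord ρ ak.2).drop A).take ρ = natToWord ρ ak.2 :=
    fun ak => by rw [List.drop_left' (length_natToWord _ _), List.take_of_length_le (length_natToWord _ _).le]
  have hmaps : Set.MapsTo f (s : Set ((_ : ℕ) × ℕ))
      ((Finset.univ.filter fun r : List.Vector Bool (A + ρ) =>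
        r.toList ∈ {blk | P (1 + bitsToNat (blk.take A)) (bitsToNat ((blk.drop A).take ρ))}) :
        Finset (List.Vector Bool (A + ρ))) := by
    intro ak hak
    rw [hs, Finset.coe_sigma, Set.mem_sigma_iff, Finset.coe_Icc, Set.mem_Icc, Finset.coe_filter,
      Set.mem_setOf_eq, Finset.mem_range] at hak
    simp only [Finset.coe_filter, Finset.mem_univ, true_and, Set.mem_setOf_eq, hf, List.Vector.toList_mk,
      htake, hdrop, bitsToNat_natToWord_of_lt hak.2.1,
      bitsToNat_natToWord_of_lt (show ak.1 - 1 < 2 ^ A by omega)]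
    rw [show 1 + (ak.1 - 1) = ak.1 by omega]
    exact hak.2.2
  have hinj : Set.InjOn f (s : Set ((_ : ℕ) × ℕ)) := by
    intro ak hak ak' hak' h
    rw [hs, Finset.coe_sigma, Set.mem_sigma_iff, Finset.coe_Icc, Set.mem_Icc, Finset.coe_filter,
      Set.mem_setOf_eq, Finset.mem_range] at hak hak'
    have h' := congrArg List.Vector.toList h
    simp only [hf, List.Vector.toList_mk] at h'
    obtain ⟨h1, h2⟩ := List.append_inj h' (by simp)
    rw [natToWord_inj_iff, Nat.mod_eq_of_lt (by omega), Nat.mod_eq_of_lt (by omega)] at h1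
    rw [natToWord_inj_iff, Nat.mod_eq_of_lt hak.2.1, Nat.mod_eq_of_lt hak'.2.1] at h2
    obtain ⟨a, k⟩ := ak
    obtain ⟨a', k'⟩ := ak'
    simp only at h1 h2 hak hak'
    have : a = a' := by omega
    subst this h2
    rfl
  exact_mod_cast Finset.card_le_card_of_injOn f hmaps hinj

/-! ### Independent trials -/

/-- `(1 − p)^T ≤ 1/4` when `Tp ≥ 3`, `0 ≤ p ≤ 1`. [folklore] -/
theorem one_sub_pow_le_quarter {p : ℝ} (hp0 : 0 ≤ p) (hp1 : p ≤ 1) {T : ℕ} (hT : 3 ≤ T * p) :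
    (1 - p) ^ T ≤ 1 / 4 := by
  have hB : 1 + (T : ℝ) * p ≤ (1 + p) ^ T := one_add_mul_le_pow (by linarith) T
  have hprod : (1 - p) ^ T * (1 + p) ^ T ≤ 1 := by
    rw [← mul_pow]
    exact pow_le_one₀ (by nlinarith) (by nlinarith)
  have hpos : (0 : ℝ) < (1 + p) ^ T := by positivity
  have h4 : (4 : ℝ) ≤ (1 + p) ^ T := by linarith
  have : (1 - p) ^ T ≤ 1 / (1 + p) ^ T := by rw [le_div_iff₀ hpos]; exact hprod
  exact this.trans (one_div_le_one_div_of_le (by norm_num) h4)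

/-- **`T` independent trials with success probability `≥ p`, `Tp ≥ 3`, succeed once with probability
`≥ 3/4`** (coin string of any length `m ≥ TL`; trial `t` reads the block `[tL, tL + L)`).
[cite: AroraBarak2009, §7.4.1] -/
theorem le_uniformProb_exists_block {L T m : ℕ} (hm : T * L ≤ m) (E : Set (List Bool)) {p : ℝ}
    (hp0 : 0 ≤ p) (hp : p ≤ uniformProb L E) (hT : 3 ≤ T * p) :
    3 / 4 ≤ uniformProb m {co | ∃ t < T, (co.drop (t * L)).take L ∈ E} := by
  have hp1 : p ≤ 1 := hp.trans (uniformProb_le_one _ _)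
  -- the failure event depends on the first `T L` coins only
  set F : Set (List Bool) := {w | ∀ t < T, (w.drop (t * L)).take L ∈ Eᶜ} with hF
  have hfail : {co : List Bool | ∃ t < T, (co.drop (t * L)).take L ∈ E}ᶜ = {co | co.take (T * L) ∈ F} := by
    ext co
    simp only [Set.mem_compl_iff, Set.mem_setOf_eq, not_exists, not_and, hF]
    refine forall_congr' fun t => forall_congr' fun ht => ?_
    rw [List.drop_take, List.take_take, min_eq_left]
    have : t * L + L ≤ T * L := by nlinarith
    omega
  have hF' : uniformProb (T * L) F ≤ 1 / 4 := by
    rw [hF, Literature.Computability.MetaComplexity.NWSamp.uniformProb_forall_blocks T L Eᶜ,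
      Literature.Computability.Complexity.uniformProb_compl]
    exact (pow_le_pow_left₀ (sub_nonneg.2 (uniformProb_le_one _ _)) (by linarith) T).trans
      (one_sub_pow_le_quarter hp0 hp1 hT)
  have hc : uniformProb m {co : List Bool | ∃ t < T, (co.drop (t * L)).take L ∈ E}ᶜ ≤ 1 / 4 := by
    rw [hfail, uniformProb_take_of_le hm]
    exact hF'
  rw [Literature.Computability.Complexity.uniformProb_compl] at hc
  linarith

/-! ### Parameters -/

/-- The number of index bits: `5 |bin n|`, so that `n⁵ < 2^{kBits n} ≤ 32 n⁵`. [folklore] -/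
def kBits (n : ℕ) : ℕ := 5 * (encodeNat n).length

/-- `n⁵ < 2^{kBits n}`. [folklore] -/
theorem pow_five_lt_two_pow_kBits (n : ℕ) : n ^ 5 < 2 ^ kBits n := by
  rw [kBits, TM2Pass.length_encodeNat_eq_size, pow_mul']
  exact Nat.pow_lt_pow_left (Nat.lt_size_self n) (by norm_num)

/-- `2^{kBits n} ≤ 32 n⁵` for `n ≥ 1`. [folklore] -/
theorem two_pow_kBits_le {n : ℕ} (hn : 1 ≤ n) : 2 ^ kBits n ≤ 32 * n ^ 5 := by
  rw [kBits, TM2Pass.length_encodeNat_eq_size, pow_mul']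
  have hs : 0 < n.size := Nat.size_pos.2 hn
  have h2 : 2 ^ n.size ≤ 2 * n := by
    have := Nat.lt_size.1 (show n.size - 1 < n.size by omega)
    rw [show n.size = n.size - 1 + 1 by omega, pow_succ]
    omega
  calc (2 ^ n.size) ^ 5 ≤ (2 * n) ^ 5 := Nat.pow_le_pow_left h2 5
    _ = 32 * n ^ 5 := by ring

/-- `log d ≤ |bin d| · log 2`. [folklore] -/
theorem log_le_length_mul_log_two (d : ℕ) : Real.log d ≤ (encodeNat d).length * Real.log 2 := by
  rcases Nat.eq_zero_or_pos d with rfl | hd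
  · simp
  rw [TM2Pass.length_encodeNat_eq_size, ← Real.log_pow]
  refine Real.log_le_log (by exact_mod_cast hd) ?_
  exact_mod_cast (Nat.lt_size_self d).le

/-- `n⁴ ≤ 2^{n−1}` for `n ≥ 18`. [folklore] -/
theorem pow_four_le_two_pow {n : ℕ} (hn : 18 ≤ n) : n ^ 4 ≤ 2 ^ (n - 1) := by
  induction n, hn using Nat.le_induction with
  | base => norm_num
  | succ k hk ih =>
    rw [show k + 1 - 1 = k - 1 + 1 by omega, pow_succ 2 (k - 1)]
    have h1 : k ^ 3 * 18 ≤ k ^ 3 * k := Nat.mul_le_mul_left (k ^ 3) hk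
    have h2 : (k + 1) ^ 4 = k ^ 3 * k + 4 * k ^ 3 + 6 * k ^ 2 + 4 * k + 1 := by ring
    have h3 : k ^ 2 ≤ k ^ 3 := Nat.pow_le_pow_right (by omega) (by norm_num)
    have h4 : k ≤ k ^ 3 := Nat.le_self_pow (by norm_num) k
    have h5 : k ^ 4 = k ^ 3 * k := pow_succ k 3
    rw [h2]
    rw [h5] at ih
    omega

/-- `|bin d|² ≤ √d` when `|bin d| ≥ 18`. [folklore] -/
theorem sq_length_le_sqrt {d : ℕ} (hn : 18 ≤ (encodeNat d).length) :
    ((encodeNat d).length : ℝ) ^ 2 ≤ Real.sqrt d := by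
  rw [TM2Pass.length_encodeNat_eq_size] at hn ⊢
  have hd : d.size - 1 < d.size := by omega
  have h2 : 2 ^ (d.size - 1) ≤ d := Nat.lt_size.1 hd
  have h4 : d.size ^ 4 ≤ d := (pow_four_le_two_pow hn).trans h2
  have h4' : ((d.size : ℝ) ^ 2) ^ 2 ≤ d := by exact_mod_cast (show (d.size ^ 2) ^ 2 ≤ d by rw [← pow_mul]; exact h4)
  calc ((d.size : ℝ)) ^ 2 = Real.sqrt ((((d.size : ℝ)) ^ 2) ^ 2) := by rw [Real.sqrt_sq (by positivity)]
    _ ≤ Real.sqrt d := Real.sqrt_le_sqrt h4'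

/-- **The largeness inequalities.** For `n = |bin d| ≥ 18` and `c · n ≥ 330`:
`4 < d`, `6π log d / c ≤ √d`, `d³ ≤ 2^{3n}`, `3π(1 + log 2^{3n})³ log d / c ≤ 2^{kBits n}` and
`3 ≤ n⁷ · (2c·2^{3n} / (3π log d) / 2^{3n + kBits n})`. [cite: Hallgren2005, §4] -/
theorem large_conditions {c : ℝ} (hc : 0 < c) {d : ℕ} (hn : 18 ≤ (encodeNat d).length)
    (hcn : 330 ≤ c * (encodeNat d).length) :
    4 < d ∧ 6 * Real.pi * Real.log d / c ≤ Real.sqrt d ∧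
      (d : ℝ) ^ 3 ≤ ((2 ^ (3 * (encodeNat d).length) : ℕ) : ℝ) ∧ 0 < 2 ^ kBits (encodeNat d).length ∧
      3 * Real.pi * (1 + Real.log ((2 ^ (3 * (encodeNat d).length) : ℕ) : ℝ)) ^ 3 * Real.log d / c ≤
        ((2 ^ kBits (encodeNat d).length : ℕ) : ℝ) ∧
      3 ≤ ((encodeNat d).length : ℝ) ^ 7 * (2 * c * ((2 ^ (3 * (encodeNat d).length) : ℕ) : ℝ) /
        (3 * Real.pi * Real.log d) / 2 ^ (3 * (encodeNat d).length + kBits (encodeNat d).length)) := by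
  set n := (encodeNat d).length with hn_def
  have hsize : n = d.size := TM2Pass.length_encodeNat_eq_size d
  have hπ := Real.pi_lt_d2
  have hπ3 := Real.pi_gt_three
  have hl2 := Real.log_two_lt_d9
  have hl2' := Real.log_two_gt_d9
  have hn1 : (1 : ℝ) ≤ n := by exact_mod_cast (show 1 ≤ n by omega)
  have hn0 : (0 : ℝ) < n := by linarith
  -- `d ≥ 2^{n-1} ≥ 2^17`
  have hdn : 2 ^ (n - 1) ≤ d := by rw [hsize]; exact Nat.lt_size.1 (by omega)
  have hd4 : 4 < d := lt_of_lt_of_le (by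
    calc 4 < 2 ^ 17 := by norm_num
      _ ≤ 2 ^ (n - 1) := Nat.pow_le_pow_right (by norm_num) (by omega)) hdn
  have hd1 : (1 : ℝ) < d := by exact_mod_cast (show 1 < d by omega)
  have hlog : 0 < Real.log d := Real.log_pos hd1
  have hlogle : Real.log d ≤ n * Real.log 2 := log_le_length_mul_log_two d
  have hlogn : Real.log d ≤ 0.6932 * n := hlogle.trans (by nlinarith)
  -- (ii)
  have hsq : (n : ℝ) ^ 2 ≤ Real.sqrt d := sq_length_le_sqrt hn
  have hii : 6 * Real.pi * Real.log d / c ≤ Real.sqrt d := by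
    rw [div_le_iff₀ hc]
    have h1 : 6 * Real.pi * Real.log d ≤ 14 * n := by nlinarith
    nlinarith
  -- (iii)
  have hdlt : d < 2 ^ n := by rw [hsize]; exact Nat.lt_size_self d
  have hiii : (d : ℝ) ^ 3 ≤ ((2 ^ (3 * n) : ℕ) : ℝ) := by
    have : d ^ 3 ≤ 2 ^ (3 * n) := by rw [pow_mul']; exact Nat.pow_le_pow_left hdlt.le 3
    exact_mod_cast this
  -- (iv), (v)
  have hR : n ^ 5 < 2 ^ kBits n := pow_five_lt_two_pow_kBits n
  have hR' : ((n : ℝ)) ^ 5 < ((2 ^ kBits n : ℕ) : ℝ) := by exact_mod_cast hR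
  have hlogY : Real.log ((2 ^ (3 * n) : ℕ) : ℝ) = 3 * n * Real.log 2 := by
    push_cast
    rw [Real.log_pow]; push_cast; ring
  have hv : 3 * Real.pi * (1 + Real.log ((2 ^ (3 * n) : ℕ) : ℝ)) ^ 3 * Real.log d / c ≤ ((2 ^ kBits n : ℕ) : ℝ) := by
    rw [div_le_iff₀ hc, hlogY]
    have h1 : 1 + 3 * n * Real.log 2 ≤ 3.1 * n := by nlinarith
    have h2 : (1 + 3 * n * Real.log 2) ^ 3 ≤ (3.1 * n) ^ 3 :=
      pow_le_pow_left₀ (by positivity) h1 3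
    have h3 : 3 * Real.pi * (1 + 3 * (n : ℝ) * Real.log 2) ^ 3 * Real.log d ≤ (196 : ℝ) * (n : ℝ) ^ 4 := by
      calc 3 * Real.pi * (1 + 3 * (n : ℝ) * Real.log 2) ^ 3 * Real.log d
          ≤ 3 * 3.15 * (3.1 * (n : ℝ)) ^ 3 * (0.6932 * n) := by gcongr
        _ ≤ 196 * (n : ℝ) ^ 4 := by ring_nf; nlinarith [pow_pos hn0 4]
    have h4 : (196 : ℝ) * (n : ℝ) ^ 4 ≤ c * (n : ℝ) ^ 5 := by nlinarith [pow_pos hn0 4]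
    nlinarith
  -- (vi)
  have hRle : 2 ^ kBits n ≤ 32 * n ^ 5 := two_pow_kBits_le (by omega)
  have hRle' : ((2 : ℝ) ^ kBits n) ≤ 32 * n ^ 5 := by exact_mod_cast hRle
  have hvi : 3 ≤ (n : ℝ) ^ 7 * (2 * c * ((2 ^ (3 * n) : ℕ) : ℝ) / (3 * Real.pi * Real.log d) / 2 ^ (3 * n + kBits n)) := by
    have hX : 2 * c * ((2 ^ (3 * n) : ℕ) : ℝ) / (3 * Real.pi * Real.log d) / 2 ^ (3 * n + kBits n) =
        2 * c / (3 * Real.pi * Real.log d * 2 ^ kBits n) := by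
      rw [pow_add, div_div, show 3 * Real.pi * Real.log d * (2 ^ (3 * n) * 2 ^ kBits n) =
        (3 * Real.pi * Real.log d * 2 ^ kBits n) * 2 ^ (3 * n) by ring]
      push_cast
      rw [mul_div_mul_right _ _ (by positivity)]
    have hD : 0 < 3 * Real.pi * Real.log d * 2 ^ kBits n := by positivity
    rw [hX, ← mul_div_assoc, le_div_iff₀ hD]
    have h1 : 3 * (3 * Real.pi * Real.log d * 2 ^ kBits n) ≤ 3 * (3 * 3.15 * (0.6932 * n) * (32 * (n : ℝ) ^ 5)) := by
      gcongr
    nlinarith [pow_pos hn0 5, pow_pos hn0 6]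
  exact ⟨hd4, hii, hiii, pow_pos (by norm_num) _, hv, hvi⟩

end TorsionWitness

end Literature.Computability.Cryptography.Hallgren2005
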